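import Summits.Ventures.PercRepro.C025ProfilePLDResLineTwelveGen

/-!
# THE SECOND TOWER'S FIRST COROLLARIES: «RESIDUAL MATROID OF RANK ≤ 12 ⊕ ANY LINE WITH ≥ 3 POINTS ⊕ FREE POINTS», IN PARTICULAR EVERY PAVING MATROID OF RANK ≤ 12 (night-3 g36)

`proofs/NIGHT3-G36-CEILING.md` §3.  `PLDResLift.pld_disjointSum_uniform_two_ge_3_of_res_eRank_le_12` gives (PLD) for `M ⊕ U_{2,3}` from the
RESIDUAL inequalities of `M` (rank ≤ 12), and the landed bridge `PLDBridge.rls_disjointSum_freeOn_of_pld` turns (PLD) into C-025 at every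
`(p, q)` on every truncation of «· ⊕ free points».  Every finite paving matroid satisfies the residual inequalities
(`PLDResCert.res_of_paving`, the injection `PavingPLD.card_residual_le_card_high`).  So: C-025 at every `(p, q)` on every truncation of
«any paving matroid of rank ≤ 12 ⊕ any line with ≥ 3 points ⊕ free points» — the (PLD)-instance tower reaches the 3-point line only at rank ≤ 6
(`C025ProfilePLDLineFarkasSeven`: `U_{2,3}` is not certifiable at rank 7) and lines with ≥ 4 points at rank ≤ 11.  No `def`, no `instance`, no notation.  Axioms: standard.
-/

open scoped Matroid

namespace PercRepro

open Finset ThmH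

namespace PLDResLift

variable {α : Type} [DecidableEq α]

/-- C-025 AT EVERY `(p, q)` ON EVERY TRUNCATION OF «RESIDUAL MATROID OF RANK ≤ 12 ⊕ ANY LINE WITH ≥ 3 POINTS ⊕ FREE POINTS». -/
theorem rls_truncate_disjointSum_line_ge_three_freeOn_of_res_twelve (M : Matroid α) [M.Finite] (hr : M.eRank ≤ 12)
    (hRES : ∀ lo hi δ : ℕ,
      (∑ I ∈ (gr M).powerset, (if lo ≤ (M.eRk (I : Set α)).toNat ∧ (M.eRk (I : Set α)).toNat ≤ hi ∧
          hi + δ + 1 ≤ (M.eRk ((gr M \ I : Finset α) : Set α)).toNat then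
          ((M.eRk ((gr M \ I : Finset α) : Set α)).toNat).choose δ else 0)) ≤
        ∑ I ∈ (gr M).powerset, (if lo + δ ≤ (M.eRk ((gr M \ I : Finset α) : Set α)).toNat ∧
          (M.eRk ((gr M \ I : Finset α) : Set α)).toNat ≤ hi + δ ∧ hi + 1 ≤ (M.eRk (I : Set α)).toNat then
          ((M.eRk ((gr M \ I : Finset α) : Set α)).toNat).choose δ else 0))
    (F : Finset α) (hF : 3 ≤ F.card)
    (h : Disjoint M.E (@Matroid.truncate α (Matroid.freeOn (F : Set α)) (PLDTruncate.freeOn_finite' F) 2).E)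
    (E₃ : Finset α)
    (h₃ : Disjoint (M.disjointSum (@Matroid.truncate α (Matroid.freeOn (F : Set α)) (PLDTruncate.freeOn_finite' F) 2) h).E (E₃ : Set α))
    (r p q : ℕ) :
    haveI := PLDTruncate.freeOn_finite' F
    haveI := PLDClosure.disjointSum_finite' _ _ h
    haveI := PLDBridge.disjointSum_freeOn_finite _ E₃ h₃
    ThmN.RLS (PercRepro.Matroid.truncate ((M.disjointSum (@Matroid.truncate α (Matroid.freeOn (F : Set α))
      (PLDTruncate.freeOn_finite' F) 2) h).disjointSum (Matroid.freeOn (E₃ : Set α)) h₃) r) p q := by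
  haveI := PLDTruncate.freeOn_finite' F
  haveI := PLDClosure.disjointSum_finite' _ _ h
  exact PLDBridge.rls_disjointSum_freeOn_of_pld _ E₃ h₃ r p q
    (pld_disjointSum_uniform_two_ge_3_of_res_eRank_le_12 M hr hRES F hF h)

/-- C-025 AT EVERY `(p, q)` ON EVERY TRUNCATION OF «PAVING MATROID OF RANK ≤ 12 ⊕ ANY LINE WITH ≥ 3 POINTS ⊕ FREE POINTS». -/
theorem rls_truncate_disjointSum_line_ge_three_freeOn_of_paving_twelve (M : Matroid α) [M.Finite] (hr : M.eRank ≤ 12)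
    (hpav : ∀ C, M.IsCircuit C → M.eRank ≤ C.encard)
    (F : Finset α) (hF : 3 ≤ F.card)
    (h : Disjoint M.E (@Matroid.truncate α (Matroid.freeOn (F : Set α)) (PLDTruncate.freeOn_finite' F) 2).E)
    (E₃ : Finset α)
    (h₃ : Disjoint (M.disjointSum (@Matroid.truncate α (Matroid.freeOn (F : Set α)) (PLDTruncate.freeOn_finite' F) 2) h).E (E₃ : Set α))
    (r p q : ℕ) :
    haveI := PLDTruncate.freeOn_finite' F
    haveI := PLDClosure.disjointSum_finite' _ _ h
    haveI := PLDBridge.disjointSum_freeOn_finite _ E₃ h₃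
    ThmN.RLS (PercRepro.Matroid.truncate ((M.disjointSum (@Matroid.truncate α (Matroid.freeOn (F : Set α))
      (PLDTruncate.freeOn_finite' F) 2) h).disjointSum (Matroid.freeOn (E₃ : Set α)) h₃) r) p q :=
  rls_truncate_disjointSum_line_ge_three_freeOn_of_res_twelve M hr (PLDResCert.res_of_paving M hpav) F hF h E₃ h₃ r p q

end PLDResLift

end PercRepro
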